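import Literature.NumberTheory.Transcendental.ExpAlgebraicTranscendenceMeasureMatrix
import Literature.NumberTheory.Transcendental.ExpAlgebraicTranscendenceMeasureLiouville
import Literature.NumberTheory.Transcendental.ExpOneTranscendenceMeasureDeterminant
import HarnessLib

/-!
# Waldschmidt 1978, Corollary 3.9 (transcendence measure for `e^β`) — proofs, part III:
# the core of the approximation measure for `e^β` (interpolation determinant, θ = β)

Sibling PROOFS file of `ExpAlgebraicTranscendenceMeasure.lean` (the named fact
`Literature.NumberTheory.Transcendental.Waldschmidt1978_cor_3_9`). Everything here is PROVED; no
definitions, no named facts.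

`Waldschmidt1978.approx_core` is steps a)–d) of the proof of the Main Theorem of
[NesterenkoWaldschmidt1996, §6] in the case `θ = β` (`β ≠ 0` algebraic, `e^β` approximated by the
algebraic number `ξ`; this is the situation of Theorem 3.8 of [Waldschmidt1978]), with the
monomial basis `z^τ e^{tβz}` (`0 ≤ τ ≤ T`, `|t| ≤ T₁`) of part II and ABSTRACT parameters: given
natural numbers `T, T₁, S, S₁` satisfying the counting condition of the zero estimate, a radius
ratio `E ≥ 1`, a bound `B` for `|ξ|^{±1}, |e^β|^{±1}`, a number field `F ∋ β, ξ` with bounds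
`[F:ℚ] ≤ D`, `[F:ℚ] h(β) ≤ H_β`, `[F:ℚ] h(ξ) ≤ H_ξ`, the smallness
`T₁S₁ B^{3T₁S₁} |ξ − e^β| E^L ≤ 1` (`L = (T+1)(2T₁+1)`) and the MAIN INEQUALITY

  `L log 2 + (1+D) L log L + (1+D) L (T log S₁ + S log(T+T₁))
    + L (T log E + S log β₊ + T₁ β₊ E S₁) + L S log E + L S H_β + 2m H_ξ + m log B < ½ L(L−1) log E`

(`β₊ = max(1,|β|)`, `m = S₁(T+1)T₁(T₁+1)`), one gets a contradiction:

* a) the matrix `a(σ,s;τ,t) = (∑ₖ qcoef β^{σ-k}) ξ^{ts}` has full column rank (part II,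
  `algMatrix_mulVec_eq_zero_beta`), so some `L × L` minor `𝒟` is non-zero;
* b) `𝒟 = det(f_{τ,t}^{(σ_μ)}(s_μ) + p_{μ,(τ,t)})` with `|p| ≤ E^{-L} 𝔐`,
  `𝔐 = (ES₁)^T ((T+T₁)β₊)^S e^{T₁β₊ES₁}`, so the analytic estimate for interpolation determinants
  (part IV of the `ExpOne` files, `NW1996.norm_det_interpolation_deriv_le`, [NesterenkoWaldschmidt1996,
  Lemma 3]) gives `|𝒟| ≤ 2^L L! 𝔐^L E^{LS} / E^{L(L-1)/2}`;
* c) `ξ^m 𝒟 = ∑_l a_l β^{e₁ l} ξ^{e₂ l}` with `a_l ∈ ℤ`, `∑|a_l| ≤ L! 𝔓^L` (`𝔓 = S₁^T (T+T₁)^S`),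
  `e₁ ≤ LS`, `e₂ ≤ 2m` (part II, `det_expand`), so Liouville's inequality in `F` (part I,
  `liouville₂`) gives `log |𝒟| ≥ −D(L log L + L log 𝔓) − LS H_β − 2m H_ξ − m log B`;
* d) the two bounds contradict the main inequality.

The choice of the parameters and of the constant (Theorem 3.8 itself) is the next part.

## References

* [NesterenkoWaldschmidt1996] Yu. V. Nesterenko, M. Waldschmidt, Mat. Zapiski 2 (1996) 23–42
  (arXiv:math/0002047), §6 a)–d), Lemmas 3, 5, 6.
* [Waldschmidt1978] M. Waldschmidt, J. Austral. Math. Soc. (A) 25 (1978) 445–465, Theorem 3.8.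
-/

noncomputable section

open Polynomial Finset Complex Matrix

namespace Literature.NumberTheory.Transcendental

namespace Waldschmidt1978

open NW1996

-- one long proof (steps a)–d) share the matrix data); the default heartbeat budget is exceeded (~2×)
set_option maxHeartbeats 800000 in
/-- **The core of the approximation measure for `e^β`** ([NesterenkoWaldschmidt1996, §6 a)–d)]
for `θ = β`, abstract parameters; see the module docstring). Under the counting condition of the
zero estimate, the smallness of `|ξ − e^β|` and the main inequality, the interpolation determinant
is both non-zero with a Liouville lower bound and analytically small: contradiction.
[cite: NesterenkoWaldschmidt1996, §6] -/
theorem approx_core {β ξ : ℂ} (hβ0 : β ≠ 0) (hξ0 : ξ ≠ 0)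
    (F : IntermediateField ℚ ℂ) [FiniteDimensional ℚ F] (hβF : β ∈ F) (hξF : ξ ∈ F)
    {Dr Hβ Hξ : ℝ} (hDr : (Module.finrank ℚ F : ℝ) ≤ Dr)
    (hHβ : (Module.finrank ℚ F : ℝ) * weilHeight₁ F (fun _ : Unit => β) ≤ Hβ)
    (hHξ : (Module.finrank ℚ F : ℝ) * weilHeight₁ F (fun _ : Unit => ξ) ≤ Hξ)
    {T T₁ S S₁ : ℕ} (hT₁ : 1 ≤ T₁) (hS₁ : 1 ≤ S₁)
    (h2T₁ : 2 * T₁ ≤ S + 1) (hcount : (2 * T₁ + 1) * T < (S + 1 - 2 * T₁) * (2 * S₁ + 1))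
    {E B : ℝ} (hE : 1 ≤ E) (hB : 1 ≤ B)
    (hξB : ‖ξ‖ ≤ B) (hξB' : ‖ξ‖⁻¹ ≤ B) (hwB : ‖cexp β‖ ≤ B) (hwB' : ‖cexp β‖⁻¹ ≤ B)
    (hδ : ((T₁ * S₁ : ℕ) : ℝ) * B ^ (3 * (T₁ * S₁)) * ‖ξ - cexp β‖ *
      E ^ ((T + 1) * (2 * T₁ + 1)) ≤ 1)
    (hmain :
      (((T + 1) * (2 * T₁ + 1) : ℕ) : ℝ) * Real.log 2 +
        (1 + Dr) * (((T + 1) * (2 * T₁ + 1) : ℕ) : ℝ) * Real.log (((T + 1) * (2 * T₁ + 1) : ℕ) : ℝ) +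
        (1 + Dr) * (((T + 1) * (2 * T₁ + 1) : ℕ) : ℝ) *
          (T * Real.log S₁ + S * Real.log ((T : ℝ) + T₁)) +
        (((T + 1) * (2 * T₁ + 1) : ℕ) : ℝ) *
          (T * Real.log E + S * Real.log (max 1 ‖β‖) + T₁ * max 1 ‖β‖ * E * S₁) +
        (((T + 1) * (2 * T₁ + 1) : ℕ) : ℝ) * S * Real.log E +
        (((T + 1) * (2 * T₁ + 1) : ℕ) : ℝ) * S * Hβ +
        2 * ((S₁ * (T + 1) * (T₁ * (T₁ + 1)) : ℕ) : ℝ) * Hξ +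
        ((S₁ * (T + 1) * (T₁ * (T₁ + 1)) : ℕ) : ℝ) * Real.log B <
      (((T + 1) * (2 * T₁ + 1) : ℕ) : ℝ) * ((((T + 1) * (2 * T₁ + 1) : ℕ) : ℝ) - 1) / 2 * Real.log E) :
    False := by
  classical
  /- names -/
  set L : ℕ := (T + 1) * (2 * T₁ + 1) with hL
  set m : ℕ := S₁ * (T + 1) * (T₁ * (T₁ + 1)) with hm
  set lgE : ℝ := Real.log E with hlgE
  set βp : ℝ := max 1 ‖β‖ with hβp
  set W : ℝ := T₁ * βp with hW
  have hE0 : 0 < E := by linarith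
  have hB0 : 0 < B := by linarith
  have hexpE : Real.exp lgE = E := by rw [hlgE, Real.exp_log hE0]
  have hlgE0 : 0 ≤ lgE := by rw [hlgE]; exact Real.log_nonneg hE
  have hβp1 : 1 ≤ βp := by rw [hβp]; exact le_max_left _ _
  have hβnorm : ‖β‖ ≤ βp := by rw [hβp]; exact le_max_right _ _
  have hβp0 : 0 < βp := by linarith
  have hT₁r : (1 : ℝ) ≤ T₁ := by exact_mod_cast hT₁
  have hS₁r : (1 : ℝ) ≤ S₁ := by exact_mod_cast hS₁
  have hW1 : 1 ≤ W := by rw [hW]; nlinarith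
  -- make the abbreviations opaque (their values are only used through the equations above)
  clear_value L m lgE βp W
  set w₀ : ℂ := cexp β with hw₀
  set δ : ℝ := ‖ξ - w₀‖ with hδdef
  have hw₀0 : w₀ ≠ 0 := Complex.exp_ne_zero β
  have hL1 : 1 ≤ L := by
    rw [hL]; exact Nat.one_le_iff_ne_zero.mpr (Nat.mul_ne_zero (by omega) (by omega))
  have hLpos : (0 : ℝ) < L := by exact_mod_cast hL1
  have hL1r : (1 : ℝ) ≤ L := by exact_mod_cast hL1
  /- a) the matrix and a non-singular minor -/
  set A : Matrix (Fin (S + 1) × Fin (2 * S₁ + 1)) (Fin (T + 1) × Fin (2 * T₁ + 1)) ℂ :=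
    Matrix.of fun ω μ =>
      (∑ k ∈ range ((ω.1 : ℕ) + 1),
          ((((ω.1 : ℕ).choose k : ℤ) * ((μ.1 : ℕ).descFactorial k : ℤ) *
              (((ω.2 : ℕ) : ℤ) - S₁) ^ ((μ.1 : ℕ) - k) * (((μ.2 : ℕ) : ℤ) - T₁) ^ ((ω.1 : ℕ) - k) : ℤ) : ℂ) *
            β ^ ((ω.1 : ℕ) - k)) *
        ξ ^ (((μ.2 : ℤ) - T₁) * ((ω.2 : ℤ) - S₁)) with hA
  have hcols : ∀ c, A *ᵥ c = 0 → c = 0 :=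
    fun c hc => algMatrix_mulVec_eq_zero_beta hβ0 hξ0 h2T₁ hcount c hc
  obtain ⟨r, hr⟩ := exists_submatrix_det_ne_zero A hcols
  -- abbreviations for the chosen rows
  set σr : Fin (T + 1) × Fin (2 * T₁ + 1) → ℕ := fun i => ((r i).1 : ℕ) with hσr
  set sr : Fin (T + 1) × Fin (2 * T₁ + 1) → ℤ := fun i => ((r i).2 : ℤ) - S₁ with hsr
  set tc : Fin (T + 1) × Fin (2 * T₁ + 1) → ℤ := fun j => ((j.2 : ℤ) - T₁) with htc
  have hσrS : ∀ i, σr i ≤ S := fun i => Nat.lt_succ_iff.mp (r i).1.isLt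
  have hsrS : ∀ i, |sr i| ≤ S₁ := fun i => abs_coord_le S₁ (r i).2
  have htcT : ∀ j, |tc j| ≤ T₁ := fun j => abs_coord_le T₁ j.2
  have hτT : ∀ j : Fin (T + 1) × Fin (2 * T₁ + 1), (j.1 : ℕ) ≤ T := fun j => Nat.lt_succ_iff.mp j.1.isLt
  -- the `β`-polynomial of the entry `(i, j)` (written out; `qcoef` of part II)
  set qs : (Fin (T + 1) × Fin (2 * T₁ + 1)) → (Fin (T + 1) × Fin (2 * T₁ + 1)) → ℂ :=
    fun i j => ∑ k ∈ range (σr i + 1),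
      ((((σr i).choose k : ℤ) * ((j.1 : ℕ).descFactorial k : ℤ) *
          (sr i) ^ ((j.1 : ℕ) - k) * (tc j) ^ (σr i - k) : ℤ) : ℂ) * β ^ (σr i - k) with hqs
  set Asq : Matrix (Fin (T + 1) × Fin (2 * T₁ + 1)) (Fin (T + 1) × Fin (2 * T₁ + 1)) ℂ :=
    A.submatrix r id with hAsq
  have hAsq_apply : ∀ i j, Asq i j = qs i j * ξ ^ (tc j * sr i) := by
    intro i j; simp [hAsq, hA, hσr, hsr, htc, hqs]
  have hdet : Asq.det ≠ 0 := hr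
  have hcard : Fintype.card (Fin (T + 1) × Fin (2 * T₁ + 1)) = L := by
    simp [Fintype.card_prod, Fintype.card_fin, hL]
  /- b) the analytic upper bound -/
  set f : Fin (T + 1) × Fin (2 * T₁ + 1) → ℂ → ℂ :=
    fun j z => z ^ (j.1 : ℕ) * cexp ((tc j : ℂ) * β * z) with hf
  have hf_diff : ∀ j, Differentiable ℂ (f j) := fun j => differentiable_monomialExp _ _
  set ζ : Fin (T + 1) × Fin (2 * T₁ + 1) → ℂ := fun i => ((sr i : ℤ) : ℂ) with hζ
  set P : Fin (T + 1) × Fin (2 * T₁ + 1) → Fin (T + 1) × Fin (2 * T₁ + 1) → ℂ :=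
    fun i j => Asq i j - iteratedDeriv (σr i) (f j) (ζ i) with hP
  set 𝔓 : ℝ := (S₁ : ℝ) ^ T * ((T : ℝ) + T₁) ^ S with h𝔓
  set 𝔐 : ℝ := (E * S₁) ^ T * (((T : ℝ) + T₁) * βp) ^ S * Real.exp (W * (E * S₁)) with h𝔐
  have h𝔓pos : 0 < 𝔓 := by rw [h𝔓]; positivity
  have h𝔐pos : 0 < 𝔐 := by rw [h𝔐]; positivity
  have hES₁ : 1 ≤ E * S₁ := one_le_mul_of_one_le_of_one_le hE hS₁r
  have hζS₁ : ∀ i, ‖ζ i‖ ≤ S₁ := by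
    intro i
    simp only [hζ, Complex.norm_intCast]
    have := hsrS i
    rw [← Int.cast_abs]; exact_mod_cast this
  have htcβ : ∀ j, ‖(tc j : ℂ) * β‖ ≤ W := by
    intro j
    rw [norm_mul, Complex.norm_intCast, hW]
    have h1 : |(tc j : ℝ)| ≤ T₁ := by rw [← Int.cast_abs]; exact_mod_cast htcT j
    exact mul_le_mul h1 hβnorm (norm_nonneg _) (by positivity)
  have hfM : ∀ i j z, ‖z‖ ≤ E * (S₁ : ℝ) → ‖iteratedDeriv (σr i) (f j) z‖ ≤ 𝔐 := by
    intro i j z hz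
    have h := norm_iteratedDeriv_monomialExp_le' (hσrS i) (hτT j) hW1 (htcβ j) hES₁ hz
    refine h.trans ?_
    rw [h𝔐]
    have hTW : (T : ℝ) + W ≤ ((T : ℝ) + T₁) * βp := by
      rw [hW, add_mul]
      have : (T : ℝ) ≤ T * βp := le_mul_of_one_le_right (Nat.cast_nonneg _) hβp1
      linarith
    have hTW0 : 0 ≤ (T : ℝ) + W := by positivity
    gcongr
  -- the unperturbed values
  have hγ : ∀ i j, iteratedDeriv (σr i) (f j) (ζ i) = qs i j * w₀ ^ (tc j * sr i) := by
    intro i j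
    have := iteratedDeriv_monomialExp_beta β (σr i) (j.1 : ℕ) (sr i) (tc j)
    simpa [hf, hζ, hqs, hw₀] using this
  -- the perturbation
  set N : ℕ := T₁ * S₁ with hN
  have htsN : ∀ i j, |tc j * sr i| ≤ N := by
    intro i j
    rw [abs_mul, hN]; push_cast
    exact mul_le_mul (htcT j) (hsrS i) (abs_nonneg _) (by positivity)
  set ε : ℝ := (E ^ L)⁻¹ with hε
  have hεpos : 0 < ε := by rw [hε]; positivity
  have hNBδ : (N : ℝ) * B ^ (3 * N) * δ ≤ ε := by
    have h1 : (N : ℝ) * B ^ (3 * N) * δ * E ^ L ≤ 1 := hδ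
    have hEL : (0 : ℝ) < E ^ L := by positivity
    rw [hε, inv_eq_one_div, le_div_iff₀ hEL]
    exact h1
  have hqs_norm : ∀ i j, ‖qs i j‖ ≤ 𝔓 * βp ^ S := by
    intro i j
    have := norm_sum_qcoef_mul_pow_le (hσrS i) (hτT j) hS₁ hT₁ (hsrS i) (htcT j) β
    simpa [hqs, h𝔓, hβp] using this
  have hPM : ∀ i j, ‖P i j‖ ≤ ε * 𝔐 := by
    intro i j
    have hPij : P i j = qs i j * (ξ ^ (tc j * sr i) - w₀ ^ (tc j * sr i)) := by
      simp only [hP]; rw [hAsq_apply, hγ]; ring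
    rw [hPij, norm_mul]
    have h2 : ‖ξ ^ (tc j * sr i) - w₀ ^ (tc j * sr i)‖ ≤ N * B ^ (3 * N) * δ :=
      norm_zpow_sub_zpow_le' hB hξB hwB hξ0 hw₀0 hξB' hwB' (htsN i j)
    have h3 : 𝔓 * βp ^ S ≤ 𝔐 := by
      rw [h𝔐, h𝔓, mul_pow, mul_pow]
      have hET : (1 : ℝ) ≤ E ^ T := one_le_pow₀ hE
      have hex : (1 : ℝ) ≤ Real.exp (W * (E * S₁)) := Real.one_le_exp (by positivity)
      have h0 : (0 : ℝ) ≤ (S₁ : ℝ) ^ T * ((T : ℝ) + T₁) ^ S * βp ^ S := by positivity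
      calc (S₁ : ℝ) ^ T * ((T : ℝ) + T₁) ^ S * βp ^ S
          = 1 * ((S₁ : ℝ) ^ T * ((T : ℝ) + T₁) ^ S * βp ^ S) * 1 := by ring
        _ ≤ E ^ T * ((S₁ : ℝ) ^ T * ((T : ℝ) + T₁) ^ S * βp ^ S) * Real.exp (W * (E * S₁)) :=
            mul_le_mul (mul_le_mul_of_nonneg_right hET h0) hex zero_le_one (by positivity)
        _ = E ^ T * (S₁ : ℝ) ^ T * (((T : ℝ) + T₁) ^ S * βp ^ S) * Real.exp (W * (E * S₁)) := by ring
    calc ‖qs i j‖ * ‖ξ ^ (tc j * sr i) - w₀ ^ (tc j * sr i)‖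
        ≤ (𝔓 * βp ^ S) * (N * B ^ (3 * N) * δ) :=
          mul_le_mul (hqs_norm i j) h2 (norm_nonneg _) (by positivity)
      _ ≤ 𝔐 * ε := mul_le_mul h3 hNBδ (by positivity) h𝔐pos.le
      _ = ε * 𝔐 := mul_comm _ _
  have hεE : ε * E ^ Fintype.card (Fin (T + 1) × Fin (2 * T₁ + 1)) ≤ 1 := by
    rw [hcard, hε, inv_mul_cancel₀ (by positivity)]
  have hAsq_eq : Asq = Matrix.of fun i j => iteratedDeriv (σr i) (f j) (ζ i) + P i j := by
    ext i j; simp [hP]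
  have hup := norm_det_interpolation_deriv_le f hf_diff σr ζ P hE hζS₁ h𝔐pos.le hεpos.le hεE hfM hPM
  rw [← hAsq_eq, hcard] at hup
  have hsumσ : ∑ i, σr i ≤ L * S := by
    calc ∑ i, σr i ≤ ∑ _i : Fin (T + 1) × Fin (2 * T₁ + 1), S := Finset.sum_le_sum fun i _ => hσrS i
      _ = L * S := by rw [Finset.sum_const, Finset.card_univ, hcard, smul_eq_mul]
  have hUB : ‖Asq.det‖ * E ^ (∑ x ∈ range L, x) ≤ 2 ^ L * (L : ℝ) ^ L * 𝔐 ^ L * E ^ (L * S) := by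
    have h1 : ‖Asq.det‖ ≤ 2 ^ L * (L.factorial : ℝ) * 𝔐 ^ L * E ^ (∑ i, σr i) / E ^ (∑ x ∈ range L, x) := hup
    rw [le_div_iff₀ (by positivity)] at h1
    refine h1.trans ?_
    have h2 : (L.factorial : ℝ) ≤ (L : ℝ) ^ L := by exact_mod_cast Nat.factorial_le_pow L
    have h3 : E ^ (∑ i, σr i) ≤ E ^ (L * S) := pow_le_pow_right₀ hE hsumσ
    gcongr
  /- c) the arithmetic lower bound -/
  -- integer data of the expansion
  set pZ : (Fin (T + 1) × Fin (2 * T₁ + 1)) → (Fin (T + 1) × Fin (2 * T₁ + 1)) → ℕ → ℤ :=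
    fun i j k => ((σr i).choose k : ℤ) * ((j.1 : ℕ).descFactorial k : ℤ) *
      (sr i) ^ ((j.1 : ℕ) - k) * (tc j) ^ (σr i - k) with hpZ
  set dZ : (Fin (T + 1) × Fin (2 * T₁ + 1)) → ℕ → ℕ := fun i k => σr i - k with hdZ
  set ex : Fin (T + 1) × Fin (2 * T₁ + 1) → Fin (T + 1) × Fin (2 * T₁ + 1) → ℕ :=
    fun i j => Int.toNat (tc j * sr i + |tc j| * S₁) with hex
  have hex_nonneg : ∀ i j, 0 ≤ tc j * sr i + |tc j| * S₁ := fun i j => shift_nonneg (hsrS i)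
  have hex_cast : ∀ i j, ((ex i j : ℕ) : ℤ) = tc j * sr i + |tc j| * S₁ := fun i j =>
    Int.toNat_of_nonneg (hex_nonneg i j)
  set nsh : Fin (T + 1) × Fin (2 * T₁ + 1) → ℕ := fun j => (tc j).natAbs * S₁ with hnsh
  have hm_eq : ∑ j, nsh j = m := by
    simp only [hnsh, htc]
    rw [← Finset.sum_mul, Fintype.sum_prod_type]
    simp only [Finset.sum_const, Finset.card_univ, Fintype.card_fin, smul_eq_mul]
    rw [sum_natAbs_sub_eq T₁, hm]; ring
  have hpow_ex : ∀ i j, ξ ^ (ex i j) = ξ ^ (nsh j) * ξ ^ (tc j * sr i) := by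
    intro i j
    rw [← zpow_natCast, hex_cast, zpow_add₀ hξ0, mul_comm, ← zpow_natCast]
    congr 1
    simp only [hnsh, Nat.cast_mul, Int.natCast_natAbs]
  -- the matrix `ξ^{nsh j} Asq i j` in the form of `det_expand`
  set M' : Matrix (Fin (T + 1) × Fin (2 * T₁ + 1)) (Fin (T + 1) × Fin (2 * T₁ + 1)) ℂ :=
    Matrix.of fun i j => (∑ k ∈ range (S + 1), (pZ i j k : ℂ) * β ^ dZ i k) * ξ ^ ex i j with hM'
  have hqs_ext : ∀ i j, ∑ k ∈ range (S + 1), (pZ i j k : ℂ) * β ^ dZ i k = qs i j := by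
    intro i j
    simp only [hpZ, hdZ, hqs]
    exact sum_range_qcoef_mul_eq (hσrS i) (j.1 : ℕ) (sr i) (tc j) (fun k => β ^ (σr i - k))
  have hM'_eq : M' = Matrix.of fun i j => ξ ^ (nsh j) * Asq i j := by
    ext i j
    simp only [hM', Matrix.of_apply, hqs_ext, hAsq_apply, hpow_ex]
    ring
  have hdetM' : M'.det = ξ ^ m * Asq.det := by
    rw [hM'_eq, Matrix.det_mul_row, Finset.prod_pow_eq_pow_sum, hm_eq]
  have hdetM'ne : M'.det ≠ 0 := by
    rw [hdetM']; exact mul_ne_zero (pow_ne_zero _ hξ0) hdet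
  -- the expansion
  set sIdx := (univ : Finset (Equiv.Perm (Fin (T + 1) × Fin (2 * T₁ + 1)))) ×ˢ
    Fintype.piFinset (fun _ : Fin (T + 1) × Fin (2 * T₁ + 1) => range (S + 1)) with hsIdx
  set aZ : Equiv.Perm (Fin (T + 1) × Fin (2 * T₁ + 1)) × ((Fin (T + 1) × Fin (2 * T₁ + 1)) → ℕ) → ℤ :=
    fun l => ((Equiv.Perm.sign l.1 : ℤˣ) : ℤ) * ∏ j, pZ (l.1 j) j (l.2 j) with haZ
  set e₁ : Equiv.Perm (Fin (T + 1) × Fin (2 * T₁ + 1)) × ((Fin (T + 1) × Fin (2 * T₁ + 1)) → ℕ) → ℕ :=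
    fun l => ∑ j, dZ (l.1 j) (l.2 j) with he₁
  set e₂ : Equiv.Perm (Fin (T + 1) × Fin (2 * T₁ + 1)) × ((Fin (T + 1) × Fin (2 * T₁ + 1)) → ℕ) → ℕ :=
    fun l => ∑ j, ex (l.1 j) j with he₂
  have hexpand : M'.det = ∑ l ∈ sIdx, (aZ l : ℂ) * β ^ e₁ l * ξ ^ e₂ l := by
    rw [hM', det_expand]
  have hv : ∑ l ∈ sIdx, (aZ l : ℂ) * β ^ e₁ l * ξ ^ e₂ l ≠ 0 := by rw [← hexpand]; exact hdetM'ne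
  -- degrees
  have hex_le : ∀ i j, ex i j ≤ 2 * nsh j := by
    intro i j
    have h1 : ((ex i j : ℕ) : ℤ) ≤ 2 * (|tc j| * S₁) := by rw [hex_cast]; exact shift_le (hsrS i)
    have h2 : ((nsh j : ℕ) : ℤ) = |tc j| * S₁ := by
      simp only [hnsh, Nat.cast_mul, Int.natCast_natAbs]
    rw [← h2] at h1
    exact_mod_cast h1
  have hD : ∀ l ∈ sIdx, e₁ l ≤ L * S ∧ e₂ l ≤ 2 * m := by
    intro l _
    constructor
    · calc e₁ l = ∑ j, (σr (l.1 j) - l.2 j) := rfl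
        _ ≤ ∑ _j : Fin (T + 1) × Fin (2 * T₁ + 1), S :=
            Finset.sum_le_sum fun j _ => (Nat.sub_le _ _).trans (hσrS _)
        _ = L * S := by rw [Finset.sum_const, Finset.card_univ, hcard, smul_eq_mul]
    · calc e₂ l = ∑ j, ex (l.1 j) j := rfl
        _ ≤ ∑ j, 2 * nsh j := Finset.sum_le_sum fun j _ => hex_le (l.1 j) j
        _ = 2 * m := by rw [← Finset.mul_sum, hm_eq]
  -- length
  have h𝔓L : ∀ i j, ∑ k ∈ range (S + 1), |(pZ i j k : ℝ)| ≤ 𝔓 := by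
    intro i j
    have hext : ∑ k ∈ range (S + 1), |(pZ i j k : ℝ)| = ∑ k ∈ range (σr i + 1), |(pZ i j k : ℝ)| := by
      symm
      refine Finset.sum_subset (Finset.range_subset_range.mpr (by have := hσrS i; omega))
        fun k _ hkσ => ?_
      have hk : σr i < k := by simp only [Finset.mem_range, not_lt] at hkσ; omega
      simp only [hpZ]
      rw [qcoef_eq_zero_of_lt (j.1 : ℕ) (sr i) (tc j) hk]; simp
    rw [hext]
    have := sum_abs_qcoef_le (hσrS i) (hτT j) hS₁ hT₁ (hsrS i) (htcT j)
    simpa [hpZ, h𝔓] using this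
  have hlen : ∑ l ∈ sIdx, |(aZ l : ℝ)| ≤ (L : ℝ) ^ L * 𝔓 ^ L := by
    have h := sum_abs_detCoeff_le pZ S h𝔓L
    rw [hcard] at h
    refine le_trans (le_of_eq ?_) (h.trans ?_)
    · rfl
    · have h2 : (L.factorial : ℝ) ≤ (L : ℝ) ^ L := by exact_mod_cast Nat.factorial_le_pow L
      exact mul_le_mul_of_nonneg_right h2 (by positivity)
  -- Liouville
  have hLiou := liouville₂ F hβF hξF sIdx aZ e₁ e₂ hD hv
  set Λ : ℝ := (L : ℝ) ^ L * 𝔓 ^ L with hΛ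
  have hΛ1 : 1 ≤ Λ := by
    rw [hΛ]
    refine one_le_mul_of_one_le_of_one_le (one_le_pow₀ hL1r) (one_le_pow₀ ?_)
    rw [h𝔓]
    refine one_le_mul_of_one_le_of_one_le (one_le_pow₀ hS₁r) (one_le_pow₀ ?_)
    linarith [(Nat.cast_nonneg T : (0 : ℝ) ≤ T)]
  have hlogmax : Real.log (max 1 (∑ l ∈ sIdx, |(aZ l : ℝ)|)) ≤ L * Real.log L + L * Real.log 𝔓 := by
    have h1 : max 1 (∑ l ∈ sIdx, |(aZ l : ℝ)|) ≤ Λ := max_le hΛ1 hlen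
    calc Real.log (max 1 (∑ l ∈ sIdx, |(aZ l : ℝ)|)) ≤ Real.log Λ :=
          Real.log_le_log (lt_of_lt_of_le one_pos (le_max_left _ _)) h1
      _ = L * Real.log L + L * Real.log 𝔓 := by
          rw [hΛ, Real.log_mul (by positivity) (by positivity), Real.log_pow, Real.log_pow]
  -- `log |v| ≥ -Λ₁`
  set Λ₁ : ℝ := Dr * (L * Real.log L + L * Real.log 𝔓) + (L * S : ℕ) * Hβ + (2 * m : ℕ) * Hξ with hΛ₁
  have hfin0 : (0 : ℝ) ≤ Module.finrank ℚ F := Nat.cast_nonneg _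
  have hlogv : -Λ₁ ≤ Real.log ‖∑ l ∈ sIdx, (aZ l : ℂ) * β ^ e₁ l * ξ ^ e₂ l‖ := by
    refine le_trans ?_ hLiou
    rw [neg_le_neg_iff, hΛ₁]
    have hlog0 : 0 ≤ Real.log (max 1 (∑ l ∈ sIdx, |(aZ l : ℝ)|)) := Real.log_nonneg (le_max_left _ _)
    have h1 : (Module.finrank ℚ F : ℝ) * Real.log (max 1 (∑ l ∈ sIdx, |(aZ l : ℝ)|)) ≤
        Dr * (L * Real.log L + L * Real.log 𝔓) :=
      mul_le_mul hDr hlogmax hlog0 (hfin0.trans hDr)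
    have h2 : (Module.finrank ℚ F : ℝ) * (((L * S : ℕ) : ℝ) * weilHeight₁ F (fun _ : Unit => β)) ≤
        ((L * S : ℕ) : ℝ) * Hβ := by
      calc (Module.finrank ℚ F : ℝ) * (((L * S : ℕ) : ℝ) * weilHeight₁ F (fun _ : Unit => β))
          = ((L * S : ℕ) : ℝ) * ((Module.finrank ℚ F : ℝ) * weilHeight₁ F (fun _ : Unit => β)) := by ring
        _ ≤ ((L * S : ℕ) : ℝ) * Hβ := mul_le_mul_of_nonneg_left hHβ (Nat.cast_nonneg _)
    have h3 : (Module.finrank ℚ F : ℝ) * (((2 * m : ℕ) : ℝ) * weilHeight₁ F (fun _ : Unit => ξ)) ≤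
        ((2 * m : ℕ) : ℝ) * Hξ := by
      calc (Module.finrank ℚ F : ℝ) * (((2 * m : ℕ) : ℝ) * weilHeight₁ F (fun _ : Unit => ξ))
          = ((2 * m : ℕ) : ℝ) * ((Module.finrank ℚ F : ℝ) * weilHeight₁ F (fun _ : Unit => ξ)) := by ring
        _ ≤ ((2 * m : ℕ) : ℝ) * Hξ := mul_le_mul_of_nonneg_left hHξ (Nat.cast_nonneg _)
    calc (Module.finrank ℚ F : ℝ) * (Real.log (max 1 (∑ l ∈ sIdx, |(aZ l : ℝ)|)) +
          ((L * S : ℕ) : ℝ) * weilHeight₁ F (fun _ : Unit => β) +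
          ((2 * m : ℕ) : ℝ) * weilHeight₁ F (fun _ : Unit => ξ))
        = (Module.finrank ℚ F : ℝ) * Real.log (max 1 (∑ l ∈ sIdx, |(aZ l : ℝ)|)) +
          (Module.finrank ℚ F : ℝ) * (((L * S : ℕ) : ℝ) * weilHeight₁ F (fun _ : Unit => β)) +
          (Module.finrank ℚ F : ℝ) * (((2 * m : ℕ) : ℝ) * weilHeight₁ F (fun _ : Unit => ξ)) := by ring
      _ ≤ Dr * (L * Real.log L + L * Real.log 𝔓) + ((L * S : ℕ) : ℝ) * Hβ + ((2 * m : ℕ) : ℝ) * Hξ :=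
          add_le_add (add_le_add h1 h2) h3
  -- `log |det Asq| ≥ -Λ₁ - m log B`
  have hnormv : ‖∑ l ∈ sIdx, (aZ l : ℂ) * β ^ e₁ l * ξ ^ e₂ l‖ = ‖ξ‖ ^ m * ‖Asq.det‖ := by
    rw [← hexpand, hdetM', norm_mul, norm_pow]
  have hdetpos : 0 < ‖Asq.det‖ := norm_pos_iff.mpr hdet
  have hξpos : 0 < ‖ξ‖ := norm_pos_iff.mpr hξ0
  have hLB : Real.exp (-Λ₁ - m * Real.log B) ≤ ‖Asq.det‖ := by
    have h1 : -Λ₁ ≤ m * Real.log ‖ξ‖ + Real.log ‖Asq.det‖ := by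
      have := hlogv
      rw [hnormv, Real.log_mul (by positivity) hdetpos.ne', Real.log_pow] at this
      exact this
    have h2 : Real.log ‖ξ‖ ≤ Real.log B := Real.log_le_log hξpos hξB
    have h3 : (m : ℝ) * Real.log ‖ξ‖ ≤ m * Real.log B := mul_le_mul_of_nonneg_left h2 (Nat.cast_nonneg _)
    have h4 : -Λ₁ - m * Real.log B ≤ Real.log ‖Asq.det‖ := by linarith
    calc Real.exp (-Λ₁ - m * Real.log B) ≤ Real.exp (Real.log ‖Asq.det‖) := Real.exp_le_exp.mpr h4
      _ = ‖Asq.det‖ := Real.exp_log hdetpos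
  /- d) the contradiction -/
  have hcomb : Real.exp (-Λ₁ - m * Real.log B) * E ^ (∑ x ∈ range L, x) ≤
      2 ^ L * (L : ℝ) ^ L * 𝔐 ^ L * E ^ (L * S) :=
    le_trans (mul_le_mul_of_nonneg_right hLB (by positivity)) hUB
  -- everything as exponentials
  have hlog𝔓 : Real.log 𝔓 = T * Real.log S₁ + S * Real.log ((T : ℝ) + T₁) := by
    rw [h𝔓, Real.log_mul (by positivity) (by positivity), Real.log_pow, Real.log_pow]
  have hTT₁pos : (0 : ℝ) < (T : ℝ) + T₁ := by linarith [(Nat.cast_nonneg T : (0 : ℝ) ≤ T)]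
  have hlog𝔐 : Real.log 𝔐 = T * (lgE + Real.log S₁) + S * (Real.log ((T : ℝ) + T₁) + Real.log βp) +
      W * (E * S₁) := by
    rw [h𝔐, Real.log_mul (by positivity) (by positivity), Real.log_mul (by positivity) (by positivity),
      Real.log_exp, Real.log_pow, Real.log_pow, Real.log_mul hE0.ne' (by positivity),
      Real.log_mul hTT₁pos.ne' hβp0.ne', hlgE]
  have hRHS : (2 : ℝ) ^ L * (L : ℝ) ^ L * 𝔐 ^ L * E ^ (L * S) =
      Real.exp (L * Real.log 2 + L * Real.log L + L * Real.log 𝔐 + (L * S : ℕ) * lgE) := by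
    rw [Real.exp_add, Real.exp_add, Real.exp_add, Real.exp_nat_mul, Real.exp_nat_mul,
      Real.exp_nat_mul, Real.exp_nat_mul, Real.exp_log (by norm_num), Real.exp_log hLpos,
      Real.exp_log h𝔐pos, hexpE]
  -- the exponent of `E`: `∑_{x<L} x = L(L-1)/2`
  have hsumL : ((∑ x ∈ range L, x : ℕ) : ℝ) = (L : ℝ) * (L - 1) / 2 := by
    have h := Finset.sum_range_id_mul_two L
    have h' : ((∑ x ∈ range L, x : ℕ) : ℝ) * 2 = (L : ℝ) * ((L - 1 : ℕ) : ℝ) := by exact_mod_cast h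
    rw [Nat.cast_sub hL1, Nat.cast_one] at h'
    linarith only [h']
  have hLHS : Real.exp (-Λ₁ - m * Real.log B) * E ^ (∑ x ∈ range L, x) =
      Real.exp (-Λ₁ - m * Real.log B + (L : ℝ) * (L - 1) / 2 * lgE) := by
    rw [Real.exp_add, ← hexpE, ← Real.exp_nat_mul, hsumL]
  rw [hLHS, hRHS, Real.exp_le_exp, hlog𝔐] at hcomb
  -- compare with `hmain` (make the remaining abbreviations opaque first)
  clear_value Λ₁ Λ 𝔓 𝔐
  have c1 : ((L * S : ℕ) : ℝ) = (L : ℝ) * S := by push_cast; ring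
  have c2 : ((2 * m : ℕ) : ℝ) = 2 * (m : ℝ) := by push_cast; ring
  have key : (L : ℝ) * (L - 1) / 2 * lgE ≤
      (L : ℝ) * Real.log 2 + (1 + Dr) * L * Real.log L +
        (1 + Dr) * L * (T * Real.log S₁ + S * Real.log ((T : ℝ) + T₁)) +
        L * (T * lgE + S * Real.log βp + W * E * S₁) + L * S * lgE + L * S * Hβ + 2 * m * Hξ +
        m * Real.log B := by
    have e : (L : ℝ) * Real.log 2 + (1 + Dr) * L * Real.log L +
        (1 + Dr) * L * (T * Real.log S₁ + S * Real.log ((T : ℝ) + T₁)) +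
        L * (T * lgE + S * Real.log βp + W * E * S₁) + L * S * lgE + L * S * Hβ + 2 * m * Hξ +
        m * Real.log B =
        ((L : ℝ) * Real.log 2 + L * Real.log L +
          L * (T * (lgE + Real.log S₁) + S * (Real.log ((T : ℝ) + T₁) + Real.log βp) + W * (E * S₁)) +
          ((L * S : ℕ) : ℝ) * lgE) + Λ₁ + m * Real.log B := by
      rw [hΛ₁, c1, c2, hlog𝔓]; ring
    have h2 : (L : ℝ) * (L - 1) / 2 * lgE ≤
        ((L : ℝ) * Real.log 2 + L * Real.log L +
          L * (T * (lgE + Real.log S₁) + S * (Real.log ((T : ℝ) + T₁) + Real.log βp) + W * (E * S₁)) +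
          ((L * S : ℕ) : ℝ) * lgE) + Λ₁ + m * Real.log B := by
      linarith only [hcomb]
    exact h2.trans_eq e.symm
  exact absurd key (not_le.mpr hmain)

end Waldschmidt1978

end Literature.NumberTheory.Transcendental

end
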